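import Literature.NumberTheory.GelbartRogawski1991.LocalDoubledUnitaryBigCellElements
import Literature.NumberTheory.GelbartRogawski1991.LocalDoubledUnitaryBigCellValue
import Literature.NumberTheory.GelbartRogawski1991.DoubledUnitaryAdaptedSiegelDet
import Literature.NumberTheory.GelbartRogawski1991.DoubledUnitaryAdaptedIwahori
import Literature.NumberTheory.Automorphic.UnitaryGroupDoubledSiegelBruhat
import Mathlib.Algebra.Polynomial.Roots
import HarnessLib

-- buildfix G11b-3 recipe (LEDGER B13-1/B13-3): elaborate sequentially so the trailing `attribute [implicit_reducible]`
-- block (reducibilityCoreExt is keyed to the async environment branch) is in force at `.olean` export.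
set_option Elab.async false

/-!
# Every `t ∈ H(F_v)` meets the translated big cell: `x(ν) · t ∈ Ω_H` for some `T₀`-skew `ν`

[cite: Kudla1994, §3; Weil1964, n° 42; HarrisKudlaSweet1996, §1 (1.11)–(1.12)]

For the doubled unitary group `H = U(T₀ ⊕ −T₀)` over `E ⊗ F_v` at a NON-SPLIT place `v` (so `E ⊗ F_v = E_w` is a
field) and its Siegel big cell `Ω_H = {C invertible}` (adapted blocks of `DoubledUnitaryAdaptedBlocks`), we prove:
for every `t ∈ H(F_v)` there is a `T₀`-skew-hermitian `ν` (`νᴴ T₀ + T₀ ν = 0`) with `det (A_t − ν C_t)` a unit,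
i.e. `x(ν) · t ∈ Ω_H` for the element `x(ν) = w · n(−ν)` of `LocalDoubledUnitaryBigCellElements`
(`exists_skew_isUnit_det`). This is the pointwise half of the left-genericity of `Ω_H` (Weil's condition (G) of
[Weil1964, n° 42] for Kudla's chunk); the uniform half (one `ν` for finitely many `t`) is root avoidance.

Proof: by the Bruhat decomposition `t = p₁ · m_χ · p₂` (`DoubledUnitary.exists_bruhat_reindex`, `p₁, p₂ ∈ P_Δ`,
`m_χ = R · (rescale · w_{E_χ} · rescale⁻¹) · R⁻¹` a partial Weyl element) the element `y = x(ν₀) p₁⁻¹` with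
`ν₀ = −δ (T₀ + T₀)` has `C_y = A(p₁⁻¹)` and `C(y t) = (1 − E_χ + δ E_χ) · A(p₂)` invertible (§2); and for ANY
`y ∈ Ω_H` with `y t ∈ Ω_H` the matrix `ν = −C_y⁻¹ D_y` is skew (the inverse relation `D T⁻¹ Cᴴ + C T⁻¹ Dᴴ = 0`,
`AdaptedBlocks.rel_inv₂₂`) and `C(y t) = C_y (A_t − ν C_t)` (§1).

## Part II — the big cell `Ω_H ⊂ H(F_v)` is left-generic at a non-split place (Weil's condition (G) for Kudla's chunk)

[cite: Weil1964, n° 42, Lemme 6 (hypothesis); Kudla1994, §3]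

For the doubled unitary group `H(F_v) = U(T₀ ⊕ −T₀)(E ⊗ F_v)` at a place `v` of `F` that does NOT split in `E` and its
Siegel big cell `Ω_H = {h : ι(h) ℓ_Δ ⋔ ℓ_Δ} = {C(h) invertible}`, every finite family of right translates
`Ω_H t⁻¹` (`t ∈ T`) has a common point (`isLeftGeneric_bigCell`): this is the hypothesis under which a function
with the multiplier property on `Ω_H` (Kudla's `φ`, `LocalDoubledUnitaryKudlaSplitting`) extends to a splitting of
the metaplectic extension over all of `H(F_v)` (`HasMultiplierOn.lift` of `GroupChunkExtension`).

Proof (root avoidance in one variable): the common point is sought among the elements `x(ν) = w · n(−ν)`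
(`ν` `T₀`-skew), for which `x(ν) t ∈ Ω_H ⟺ det (A_t − ν C_t) ∈ (E ⊗ F_v)ˣ`. For one `t` such a `ν_t` exists
(`exists_skew_isUnit_det` of Part I). Inductively, if `ν₁` serves `T` and `ν₂` serves `t`, then
on the line `ν₁ + λ (ν₂ − ν₁)`, `λ ∈ F_v`, each condition fails only at the roots of a non-zero polynomial over the
field `E ⊗ F_v = E_w` (non-zero at `λ = 0`, resp. `λ = 1`); `F_v` being infinite, some `λ` serves `T ∪ {t}`.
-/

set_option autoImplicit false

noncomputable section

open NumberField IsDedekindDomain Matrix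
open Literature.NumberTheory.Automorphic Literature.NumberTheory.Automorphic.UnitaryGroup
open Literature.NumberTheory.GelbartRogawski1991.AdaptedBlocks

/-! ## §1 Matrix algebra: `−C⁻¹D` is skew on the big cell, and `C(MN) = C_M (A_N + C_M⁻¹ D_M C_N)` -/

namespace Literature.NumberTheory.GelbartRogawski1991.AdaptedBlocks

variable {L : Type*} [CommRing L] {ι : Type*} [Fintype ι] [DecidableEq ι] {σ : L →+* L}

omit [Fintype ι] [DecidableEq ι] in
/-- `C(MN) = C_M · (A_N − (−C_M⁻¹ D_M) · C_N)` for `C_M` invertible. [cite: Kudla1994, §3] -/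
theorem blkC_mul_eq_of_isUnit [Fintype ι] [DecidableEq ι] [Invertible (2 : L)] {M : Matrix (ι ⊕ ι) (ι ⊕ ι) L}
    (hC : IsUnit (blkC M).det) (N : Matrix (ι ⊕ ι) (ι ⊕ ι) L) :
    blkC (M * N) = blkC M * (blkA N - (-((blkC M)⁻¹ * blkD M)) * blkC N) := by
  rw [blkC_mul, Matrix.neg_mul, sub_neg_eq_add, Matrix.mul_add, Matrix.mul_assoc, Matrix.mul_nonsing_inv_cancel_left _ _ hC]

end Literature.NumberTheory.GelbartRogawski1991.AdaptedBlocks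

namespace Literature.NumberTheory.GelbartRogawski1991.UnitaryDualPair.LocalSplitting

variable (F : Type) [Field F] [NumberField F] (E : Type) [Field E] [NumberField E] [Algebra F E]
  (c : E ≃ₐ[F] E)
  {δ : E} (hcδ : c δ = -δ) (hδ : δ ≠ 0) {d : F} (hd : δ * δ = algebraMap F E d)
  (v : HeightOneSpectrum (𝓞 F)) (n : ℕ) {T₀ : Matrix (Fin n) (Fin n) F} (hT₀ : T₀.IsSymm) (hT₀d : IsUnit T₀.det)
  {JD : Matrix (Fin (n + n)) (Fin (n + n)) E} (hJD : JD = (gramD F n T₀).map (algebraMap F E))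

/-! ## §2 Siegel elements and the partial Weyl elements in adapted blocks -/

/-- `matA` of the element of `H(F_v)` with matrix `p`. [cite: Kudla1994, §3] -/
theorem matA_symm_apply (p : GL (Fin (n + n)) (LocalRing E v)) (hp : p ∈ UnitaryGroup.local E c (n + n) JD v) :
    matA F E c v n ((localPiEquiv E c (n + n) JD v).symm ⟨p, hp⟩) =
      Matrix.reindex (e₂ n).symm (e₂ n).symm p.1 := by
  rw [matA, matS, (localPiEquiv E c (n + n) JD v).apply_symm_apply]

/-- `C(p⁻¹) = 0` if `C(p) = 0` (`P_Δ` is closed under inverses, block form). [cite: Kudla1994, §3] -/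
theorem blkC_matA_inv_eq_zero {p : UnitaryGroup.localPi E c (n + n) JD v} (hp : blkC (matA F E c v n p) = 0) :
    blkC (matA F E c v n p⁻¹) = 0 := by
  have h := congrArg blkC (matA_mul F E c v n p⁻¹ p)
  rw [inv_mul_cancel, matA_one, blkC_one, blkC_mul, hp, Matrix.mul_zero, add_zero] at h
  have hA : IsUnit (blkA (matA F E c v n p)).det := by
    have hu := isUnit_det_matA F E c v n p
    rw [det_eq_det_blkA_mul_det_blkD hp] at hu
    exact isUnit_of_mul_isUnit_left hu
  calc blkC (matA F E c v n p⁻¹)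
      = blkC (matA F E c v n p⁻¹) * blkA (matA F E c v n p) * (blkA (matA F E c v n p))⁻¹ :=
        (Matrix.mul_nonsing_inv_cancel_right _ _ hA).symm
    _ = 0 := by rw [h, Matrix.zero_mul]

include hcδ hT₀ in
/-- `ν₀ = −δ · (T₀ + T₀)` is `T₀`-skew-hermitian (`σ δ = −δ`, `T₀` symmetric `σ`-fixed).
[cite: Kudla1994, §3; Weil1964, n° 32] -/
theorem deltaTwoGram_skew :
    ((-(algebraMap E (LocalRing E v) δ • (gramS F E v n T₀ + gramS F E v n T₀))).map (conjLocal E c v))ᵀ *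
          gramS F E v n T₀ +
        gramS F E v n T₀ * (-(algebraMap E (LocalRing E v) δ • (gramS F E v n T₀ + gramS F E v n T₀))) = 0 := by
  have e : ((-(algebraMap E (LocalRing E v) δ • (gramS F E v n T₀ + gramS F E v n T₀))).map (conjLocal E c v))ᵀ =
      algebraMap E (LocalRing E v) δ • (gramS F E v n T₀ + gramS F E v n T₀) := by
    ext i j
    simp only [Matrix.transpose_apply, Matrix.map_apply, Matrix.neg_apply, Matrix.smul_apply, Matrix.add_apply,
      smul_eq_mul, map_neg, _root_.map_mul, map_add, conjLocal_algebraMap, hcδ, gramS, conjLocal_toLocalRing, neg_mul,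
      neg_neg]
    rw [show T₀ j i = T₀ i j from by simpa using congrFun (congrFun hT₀ i) j]
  rw [e, Matrix.smul_mul, Matrix.mul_neg, Matrix.mul_smul, Matrix.add_mul, Matrix.mul_add, add_neg_cancel]

include hcδ hδ hd hT₀ hT₀d hJD in
/-- **every `t ∈ H(F_v)` meets the translated big cell** (non-split `v`): there is a `T₀`-skew-hermitian `ν` with
`det (A_t − ν C_t)` a unit, i.e. `x(ν) · t ∈ Ω_H`. [cite: Kudla1994, §3; Weil1964, n° 42] -/
theorem exists_skew_isUnit_det [Algebra.IsQuadraticExtension F E] (w : PlacesOver E v) (hw : c • w.1 = w.1)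
    (t : UnitaryGroup.localPi E c (n + n) JD v) :
    ∃ ν : Matrix (Fin n) (Fin n) (LocalRing E v),
      (ν.map (conjLocal E c v))ᵀ * gramS F E v n T₀ + gramS F E v n T₀ * ν = 0 ∧
        IsUnit (blkA (matA F E c v n t) - ν * blkC (matA F E c v n t)).det := by
  letI : Field (LocalRing E v) := (LocalRing.isField_of_smul_eq c (galConj_ne_one F E c hcδ hδ) w hw).toField
  set S₀ : Matrix (Fin n) (Fin n) (LocalRing E v) := gramS F E v n T₀ with hS₀
  have h2 : (2 : LocalRing E v) ≠ 0 := (isUnit_of_invertible (2 : LocalRing E v)).ne_zero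
  have hσ : ∀ x, conjLocal E c v (conjLocal E c v x) = x := conjLocal_conjLocal' F E c hcδ hδ hd v
  have hSu : IsUnit S₀.det := by
    rw [hS₀, gramS, ← RingHom.mapMatrix_apply, ← RingHom.mapMatrix_apply, ← RingHom.map_det, ← RingHom.map_det]
    exact (hT₀d.map _).map _
  -- the unitarity datum of `t` in the shape of `UnitaryGroupDoubledSiegelBruhat`
  have hγ : (localPiEquiv E c (n + n) JD v t).1 ∈
      unitaryGroupOfForm (conjLocal E c v) (Matrix.reindex (e₂ n) (e₂ n) (DoubledUnitary.diagForm S₀)) := by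
    have h := mem_unitaryGroupOfForm_iff.1 (localPiEquiv E c (n + n) JD v t).2
    rw [localFormD_eq F E v n hJD] at h
    exact mem_unitaryGroupOfForm_iff.2 h
  obtain ⟨χ, hχ, hτu, p₁, p₂, hp₁, hp₂, hs₁, hs₂, hfac⟩ :=
    DoubledUnitary.exists_bruhat_reindex (σ := conjLocal E c v) (e₂ n) h2 hσ (gramS_map_conj F E c v n)
      (gramS_transpose F E v n hT₀) hSu hγ
  -- names
  set Eχ : Matrix (Fin n) (Fin n) (LocalRing E v) := Matrix.diagonal χ with hEχ
  set θ : LocalRing E v := algebraMap E (LocalRing E v) δ with hθ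
  set ψ : GL (Fin n ⊕ Fin n) (LocalRing E v) ≃* GL (Fin (n + n)) (LocalRing E v) :=
    Units.mapEquiv (Matrix.reindexRingEquiv (LocalRing E v) (e₂ n)).toMulEquiv with hψ
  set mid : GL (Fin n ⊕ Fin n) (LocalRing E v) :=
    DoubledUnitary.cayley (LocalRing E v) (Fin n) h2 *
      (DoubledUnitary.rescale (S₀ + S₀) hτu * DoubledUnitary.partialWeyl (Matrix.diagonal χ) _ *
        (DoubledUnitary.rescale (S₀ + S₀) hτu)⁻¹) * (DoubledUnitary.cayley (LocalRing E v) (Fin n) h2)⁻¹ with hmid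
  -- the local-group versions of `p₁`, `p₂`, `mid`
  have hp₁' : p₁ ∈ UnitaryGroup.local E c (n + n) JD v := by
    rw [UnitaryGroup.local, localFormD_eq F E v n hJD]; exact hp₁
  have hp₂' : p₂ ∈ UnitaryGroup.local E c (n + n) JD v := by
    rw [UnitaryGroup.local, localFormD_eq F E v n hJD]; exact hp₂
  have hmidU : ψ mid ∈ unitaryGroupOfForm (conjLocal E c v) (Matrix.reindex (e₂ n) (e₂ n) (DoubledUnitary.diagForm S₀)) := by
    have h := Subgroup.mul_mem _ (Subgroup.mul_mem _ (Subgroup.inv_mem _ hp₁) hγ) (Subgroup.inv_mem _ hp₂)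
    rwa [hfac, show p₁⁻¹ * (p₁ * ψ mid * p₂) * p₂⁻¹ = ψ mid by group] at h
  have hmid' : ψ mid ∈ UnitaryGroup.local E c (n + n) JD v := by
    rw [UnitaryGroup.local, localFormD_eq F E v n hJD]; exact hmidU
  set t₁ : UnitaryGroup.localPi E c (n + n) JD v := (localPiEquiv E c (n + n) JD v).symm ⟨p₁, hp₁'⟩ with ht₁
  set t₂ : UnitaryGroup.localPi E c (n + n) JD v := (localPiEquiv E c (n + n) JD v).symm ⟨p₂, hp₂'⟩ with ht₂
  set tm : UnitaryGroup.localPi E c (n + n) JD v := (localPiEquiv E c (n + n) JD v).symm ⟨ψ mid, hmid'⟩ with htm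
  have ht : t = t₁ * tm * t₂ := by
    apply (localPiEquiv E c (n + n) JD v).injective
    rw [_root_.map_mul, _root_.map_mul, ht₁, ht₂, htm, (localPiEquiv E c (n + n) JD v).apply_symm_apply,
      (localPiEquiv E c (n + n) JD v).apply_symm_apply, (localPiEquiv E c (n + n) JD v).apply_symm_apply]
    exact Subtype.ext hfac
  -- blocks of the Siegel factors
  have hC₁ : blkC (matA F E c v n t₁) = 0 := by
    rw [ht₁, matA_symm_apply]; exact (blkC_eq_zero_iff _).2 hs₁
  have hC₂ : blkC (matA F E c v n t₂) = 0 := by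
    rw [ht₂, matA_symm_apply]; exact (blkC_eq_zero_iff _).2 hs₂
  have hC₁' : blkC (matA F E c v n t₁⁻¹) = 0 := blkC_matA_inv_eq_zero F E c v n hC₁
  have hA₂ : IsUnit (blkA (matA F E c v n t₂)).det := by
    have hu := isUnit_det_matA F E c v n t₂
    rw [det_eq_det_blkA_mul_det_blkD hC₂] at hu
    exact isUnit_of_mul_isUnit_left hu
  -- blocks of the partial Weyl element: `A = 1 − E_χ`, `C = τ⁻¹ E_χ`
  have hcay : (DoubledUnitary.cayley (LocalRing E v) (Fin n) h2).1 = cayR (LocalRing E v) (Fin n) := rfl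
  have hcayi : ((DoubledUnitary.cayley (LocalRing E v) (Fin n) h2)⁻¹).1 * cayR (LocalRing E v) (Fin n) = 1 := by
    rw [← hcay, ← Units.val_mul, inv_mul_cancel, Units.val_one]
  have hAm : adapt (matA F E c v n tm) =
      Matrix.fromBlocks 1 0 0 (S₀ + S₀)⁻¹ * Matrix.fromBlocks (1 - Eχ) Eχ Eχ (1 - Eχ) * Matrix.fromBlocks 1 0 0 (S₀ + S₀) := by
    rw [htm, matA_symm_apply]
    have e1 : Matrix.reindex (e₂ n).symm (e₂ n).symm (ψ mid).1 = mid.1 := by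
      change Matrix.reindex (e₂ n).symm (e₂ n).symm (Matrix.reindex (e₂ n) (e₂ n) mid.1) = mid.1
      rw [Matrix.reindex_apply, Matrix.reindex_apply, Matrix.submatrix_submatrix, Equiv.symm_symm, Equiv.symm_comp_self,
        Matrix.submatrix_id_id]
    rw [e1, hmid, Units.val_mul, Units.val_mul, Units.val_mul, Units.val_mul, hcay, adapt]
    change cayRinv (LocalRing E v) (Fin n) * (cayR (LocalRing E v) (Fin n) *
        (Matrix.fromBlocks 1 0 0 (S₀ + S₀)⁻¹ * Matrix.fromBlocks (1 - Eχ) Eχ Eχ (1 - Eχ) * Matrix.fromBlocks 1 0 0 (S₀ + S₀)) *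
        ((DoubledUnitary.cayley (LocalRing E v) (Fin n) h2)⁻¹).1) * cayR (LocalRing E v) (Fin n) = _
    rw [Matrix.mul_assoc, Matrix.mul_assoc, hcayi, Matrix.mul_one, ← Matrix.mul_assoc, cayRinv_mul_cayR, Matrix.one_mul]
  have hY : Matrix.fromBlocks 1 0 0 (S₀ + S₀)⁻¹ * Matrix.fromBlocks (1 - Eχ) Eχ Eχ (1 - Eχ) * Matrix.fromBlocks 1 0 0 (S₀ + S₀) =
      Matrix.fromBlocks (1 - Eχ) (Eχ * (S₀ + S₀)) ((S₀ + S₀)⁻¹ * Eχ) ((S₀ + S₀)⁻¹ * (1 - Eχ) * (S₀ + S₀)) := by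
    simp only [Matrix.fromBlocks_multiply, Matrix.one_mul, Matrix.zero_mul, add_zero, zero_add, Matrix.mul_one,
      Matrix.mul_zero]
  have hblk := Matrix.fromBlocks_inj.1 ((adapt_eq (matA F E c v n tm)).symm.trans (hAm.trans hY))
  have hAm' : blkA (matA F E c v n tm) = 1 - Eχ := hblk.1
  have hCm' : blkC (matA F E c v n tm) = (S₀ + S₀)⁻¹ * Eχ := hblk.2.2.1
  -- the auxiliary element `y = x(ν₀) · p₁⁻¹`
  set ν₀ : Matrix (Fin n) (Fin n) (LocalRing E v) := -(θ • (S₀ + S₀)) with hν₀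
  have hν₀s : (ν₀.map (conjLocal E c v))ᵀ * gramS F E v n T₀ + gramS F E v n T₀ * ν₀ = 0 :=
    deltaTwoGram_skew F E c hcδ v n hT₀
  set y : UnitaryGroup.localPi E c (n + n) JD v := xElem F E c v n hJD ν₀ hν₀s * t₁⁻¹ with hy
  have hCy : blkC (matA F E c v n y) = blkA (matA F E c v n t₁⁻¹) := by
    rw [hy, blkC_matA_xElem_mul, hC₁', Matrix.mul_zero, sub_zero]
  have hCyu : IsUnit (blkC (matA F E c v n y)).det := by
    have hu := isUnit_det_matA F E c v n t₁⁻¹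
    rw [det_eq_det_blkA_mul_det_blkD hC₁'] at hu
    rw [hCy]
    exact isUnit_of_mul_isUnit_left hu
  -- `C(y t) = (1 − E_χ + θ E_χ) · A(p₂)`
  have hCyt : blkC (matA F E c v n (y * t)) = (1 - Eχ + θ • Eχ) * blkA (matA F E c v n t₂) := by
    rw [hy, ht, show xElem F E c v n hJD ν₀ hν₀s * t₁⁻¹ * (t₁ * tm * t₂) = xElem F E c v n hJD ν₀ hν₀s * (tm * t₂) by group,
      blkC_matA_xElem_mul, ← matA_mul, blkA_mul, blkC_mul, hC₂, Matrix.mul_zero, Matrix.mul_zero, add_zero, add_zero,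
      hAm', hCm', ← Matrix.mul_assoc, ← Matrix.sub_mul, hν₀, Matrix.neg_mul, sub_neg_eq_add, Matrix.smul_mul,
      Matrix.mul_nonsing_inv_cancel_left _ _ hτu]
  have hdiag : (1 : Matrix (Fin n) (Fin n) (LocalRing E v)) - Eχ + θ • Eχ = Matrix.diagonal fun i => 1 - χ i + θ * χ i := by
    ext i j
    by_cases hij : i = j
    · subst hij; simp [hEχ]
    · simp [hEχ, hij, Matrix.one_apply_ne hij]
  have hEu : IsUnit ((1 : Matrix (Fin n) (Fin n) (LocalRing E v)) - Eχ + θ • Eχ).det := by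
    rw [hdiag, Matrix.det_diagonal]
    refine Finset.prod_induction _ IsUnit (fun a b ha hb => ha.mul hb) isUnit_one (fun i _ => ?_)
    rcases hχ i with h0 | h1
    · rw [h0, sub_zero, mul_zero, add_zero]; exact isUnit_one
    · rw [h1, sub_self, mul_one, zero_add, hθ]; exact (IsUnit.mk0 δ hδ).map (algebraMap E (LocalRing E v))
  have hCytu : IsUnit (blkC (matA F E c v n (y * t))).det := by
    rw [hCyt, Matrix.det_mul]; exact hEu.mul hA₂
  -- the witness `ν = −C_y⁻¹ D_y`
  refine ⟨-((blkC (matA F E c v n y))⁻¹ * blkD (matA F E c v n y)), ?_, ?_⟩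
  · exact cstar_neg_invMul_skew hSu hCyu
      (rel_inv₂₂ (σ := conjLocal E c v) hSu (isUnit_det_matA F E c v n y) (cstar_matA F E c v n hJD y))
  · rw [← matA_mul, blkC_mul_eq_of_isUnit hCyu, Matrix.det_mul] at hCytu
    exact (IsUnit.mul_iff.1 hCytu).2

open Literature.RepresentationTheory.HeisenbergGroup Literature.NumberTheory.Weil1964
open Literature.LinearAlgebra.QuadraticForm Literature.GroupTheory

/-! ## §4 (Part II) `det (A − μ D)` is a polynomial in `μ` -/

/-- `det (A − μ D) = P(μ)` for the polynomial `P = det (A − X D) ∈ L[X]`. [cite: Weil1964, n° 42] -/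
theorem det_sub_smul_eq_eval {L : Type*} [CommRing L] {ι : Type*} [Fintype ι] [DecidableEq ι] (A D : Matrix ι ι L) (μ : L) :
    (A - μ • D).det =
      (Matrix.det (A.map Polynomial.C - (Polynomial.X : Polynomial L) • D.map Polynomial.C)).eval μ := by
  change _ = Polynomial.evalRingHom μ _
  rw [RingHom.map_det, RingHom.mapMatrix_apply]
  congr 1
  ext i j
  simp only [Matrix.map_apply, Matrix.sub_apply, Matrix.smul_apply, smul_eq_mul, Polynomial.coe_evalRingHom,
    Polynomial.eval_sub, Polynomial.eval_mul, Polynomial.eval_C, Polynomial.eval_X]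


/-! ## §5 The line through two skew matrices -/

/-- `T₀`-skew-hermitian matrices form an `F_v`-subspace: `ν₁ + λ (ν₂ − ν₁)` is skew for `λ ∈ F_v`.
[cite: Weil1964, n° 32] -/
theorem skew_add_smul_sub {ν₁ ν₂ : Matrix (Fin n) (Fin n) (LocalRing E v)}
    (h₁ : (ν₁.map (conjLocal E c v))ᵀ * gramS F E v n T₀ + gramS F E v n T₀ * ν₁ = 0)
    (h₂ : (ν₂.map (conjLocal E c v))ᵀ * gramS F E v n T₀ + gramS F E v n T₀ * ν₂ = 0) (a : v.adicCompletion F) :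
    ((ν₁ + toLocalRing E v a • (ν₂ - ν₁)).map (conjLocal E c v))ᵀ * gramS F E v n T₀ +
        gramS F E v n T₀ * (ν₁ + toLocalRing E v a • (ν₂ - ν₁)) = 0 := by
  have e : ((ν₁ + toLocalRing E v a • (ν₂ - ν₁)).map (conjLocal E c v))ᵀ =
      (ν₁.map (conjLocal E c v))ᵀ + toLocalRing E v a • ((ν₂.map (conjLocal E c v))ᵀ - (ν₁.map (conjLocal E c v))ᵀ) := by
    ext i j
    simp only [Matrix.transpose_apply, Matrix.map_apply, Matrix.add_apply, Matrix.smul_apply, Matrix.sub_apply,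
      smul_eq_mul, map_add, map_sub, _root_.map_mul, conjLocal_toLocalRing]
  rw [e, Matrix.add_mul, Matrix.smul_mul, Matrix.sub_mul, Matrix.mul_add, Matrix.mul_smul, Matrix.mul_sub,
    show (ν₁.map (conjLocal E c v))ᵀ * gramS F E v n T₀ +
        toLocalRing E v a • ((ν₂.map (conjLocal E c v))ᵀ * gramS F E v n T₀ - (ν₁.map (conjLocal E c v))ᵀ * gramS F E v n T₀) +
        (gramS F E v n T₀ * ν₁ + toLocalRing E v a • (gramS F E v n T₀ * ν₂ - gramS F E v n T₀ * ν₁)) =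
      ((ν₁.map (conjLocal E c v))ᵀ * gramS F E v n T₀ + gramS F E v n T₀ * ν₁) +
        toLocalRing E v a • (((ν₂.map (conjLocal E c v))ᵀ * gramS F E v n T₀ + gramS F E v n T₀ * ν₂) -
          ((ν₁.map (conjLocal E c v))ᵀ * gramS F E v n T₀ + gramS F E v n T₀ * ν₁)) from by
      rw [smul_sub, smul_sub, smul_sub, smul_add, smul_add]; abel,
    h₁, h₂, sub_zero, smul_zero, add_zero]

/-! ## §6 Left-genericity of the big cell -/

include hcδ hδ hd hT₀ hT₀d hJD in
/-- **one skew `ν` for finitely many `t`**: for every finite `T ⊆ H(F_v)` (non-split `v`) there is a `T₀`-skew `ν`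
with `det (A_t − ν C_t)` a unit for all `t ∈ T` (root avoidance along a line of skew matrices).
[cite: Weil1964, n° 42; Kudla1994, §3] -/
theorem exists_skew_forall_isUnit_det [Algebra.IsQuadraticExtension F E] (w : PlacesOver E v) (hw : c • w.1 = w.1)
    (T : Finset (UnitaryGroup.localPi E c (n + n) JD v)) :
    ∃ ν : Matrix (Fin n) (Fin n) (LocalRing E v),
      (ν.map (conjLocal E c v))ᵀ * gramS F E v n T₀ + gramS F E v n T₀ * ν = 0 ∧
        ∀ t ∈ T, IsUnit (blkA (matA F E c v n t) - ν * blkC (matA F E c v n t)).det := by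
  classical
  have hF : IsField (LocalRing E v) := LocalRing.isField_of_smul_eq c (galConj_ne_one F E c hcδ hδ) w hw
  haveI : IsDomain (LocalRing E v) := hF.isDomain
  have hunit : ∀ x : LocalRing E v, x ≠ 0 → IsUnit x := fun x hx => by
    obtain ⟨b, hb⟩ := hF.mul_inv_cancel hx
    exact IsUnit.of_mul_eq_one b hb
  haveI : CharZero (v.adicCompletion F) := charZero_of_injective_algebraMap (algebraMap F _).injective
  haveI : Infinite (v.adicCompletion F) := Infinite.of_injective _ Nat.cast_injective
  have hinj : Function.Injective (toLocalRing E v) := (toLocalRing E v).injective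
  induction T using Finset.induction_on with
  | empty =>
    refine ⟨0, ?_, fun t ht => absurd ht (Finset.notMem_empty t)⟩
    rw [Matrix.map_zero _ (map_zero _), Matrix.transpose_zero, Matrix.zero_mul, Matrix.mul_zero, add_zero]
  | insert t s _ ih =>
    obtain ⟨ν₁, hν₁, h₁⟩ := ih
    obtain ⟨ν₂, hν₂, h₂⟩ := exists_skew_isUnit_det F E c hcδ hδ hd v n hT₀ hT₀d hJD w hw t
    -- the line `λ ↦ ν₁ + λ (ν₂ − ν₁)`
    set f : v.adicCompletion F → Matrix (Fin n) (Fin n) (LocalRing E v) :=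
      fun a => ν₁ + toLocalRing E v a • (ν₂ - ν₁) with hf
    have hf0 : f 0 = ν₁ := by simp only [hf, map_zero, zero_smul, add_zero]
    have hf1 : f 1 = ν₂ := by simp only [hf, map_one, one_smul, add_sub_cancel]
    -- for each `t'` of the family, the bad `λ` form a finite set
    have hbad : ∀ t' ∈ insert t s,
        Set.Finite {a : v.adicCompletion F | ¬IsUnit (blkA (matA F E c v n t') - f a * blkC (matA F E c v n t')).det} := by
      intro t' ht'
      set A' := blkA (matA F E c v n t') - ν₁ * blkC (matA F E c v n t') with hA'
      set D' := (ν₂ - ν₁) * blkC (matA F E c v n t') with hD'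
      have hdet : ∀ a, blkA (matA F E c v n t') - f a * blkC (matA F E c v n t') = A' - toLocalRing E v a • D' := by
        intro a
        rw [hf, hA', hD', Matrix.add_mul, Matrix.smul_mul, sub_add_eq_sub_sub]
      set P : Polynomial (LocalRing E v) :=
        Matrix.det (A'.map Polynomial.C - (Polynomial.X : Polynomial (LocalRing E v)) • D'.map Polynomial.C) with hP
      have hPe : ∀ μ, (A' - μ • D').det = P.eval μ := fun μ => det_sub_smul_eq_eval A' D' μ
      have hP0 : P ≠ 0 := by
        obtain ⟨a₀, ha₀⟩ : ∃ a₀, IsUnit (blkA (matA F E c v n t') - f a₀ * blkC (matA F E c v n t')).det := by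
          rcases Finset.mem_insert.1 ht' with rfl | hs
          · exact ⟨1, by rw [hf1]; exact h₂⟩
          · exact ⟨0, by rw [hf0]; exact h₁ t' hs⟩
        intro hP0
        rw [hdet, hPe, hP0, Polynomial.eval_zero] at ha₀
        exact not_isUnit_zero ha₀
      refine ((Polynomial.finite_setOf_isRoot hP0).preimage fun _ _ _ _ hab => hinj hab).subset fun a ha => ?_
      simp only [Set.mem_preimage, Set.mem_setOf_eq, Polynomial.IsRoot.def]
      by_contra hne
      exact ha (by rw [hdet, hPe]; exact hunit _ hne)
    have hfin := (Finset.finite_toSet (insert t s)).biUnion hbad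
    obtain ⟨a, -, ha⟩ := Set.infinite_univ.exists_notMem_finset hfin.toFinset
    rw [Set.Finite.mem_toFinset, Set.mem_iUnion₂] at ha
    push Not at ha
    refine ⟨f a, skew_add_smul_sub F E c v n hν₁ hν₂ a, fun t' ht' => ?_⟩
    have := ha t' ht'
    simpa only [Set.mem_setOf_eq, not_not] using this

include hcδ hδ hd hT₀ hT₀d hJD in
/-- **THE BIG CELL `Ω_H` IS LEFT-GENERIC IN `H(F_v)`** at a non-split place: for every finite `T ⊆ H(F_v)` there is
`x ∈ H(F_v)` with `x t ∈ Ω_H` for all `t ∈ T` (namely `x = x(ν) = w · n(−ν)` for a suitable `T₀`-skew `ν`) — Weil's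
hypothesis (G) for the chunk `(Ω_H, c^{ψ'}_{ℓ_Δ} ∘ ι)`. [cite: Weil1964, n° 42, Lemme 6 (hypothesis); Kudla1994, §3] -/
theorem isLeftGeneric_bigCell [Algebra.IsQuadraticExtension F E] (w : PlacesOver E v) (hw : c • w.1 = w.1) :
    IsLeftGeneric {h : UnitaryGroup.localPi E c (n + n) JD v | iotaD F E c hcδ hδ hd v n hT₀ hJD h ∈
      bigCell (alt (polar (localPairing F (n + n) (gramD F n T₀) v))) (deltaLagrangian F v n)} := by
  intro T
  obtain ⟨ν, hν, hT⟩ := exists_skew_forall_isUnit_det F E c hcδ hδ hd v n hT₀ hT₀d hJD w hw T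
  refine ⟨xElem F E c v n hJD ν hν, fun t ht => ?_⟩
  rw [Set.mem_setOf_eq, iotaD_mem_bigCell_iff_isUnit_blkC, blkC_matA_xElem_mul, Matrix.isUnit_iff_isUnit_det]
  exact hT t ht

/-! ### Build-lane note (ops-buildfix G11b-3 recipe, LEDGER B13-1, 2026-08-21)
`lean -o` (the hub build lane, never `lean`/the gate check) runs Lean 4.32's library-suggestion indexers
(`Lean.LibrarySuggestions.SymbolFrequency` / `SineQuaNon`, from their `exportEntriesFn`) over the statement of
every local theorem that is not a denied premise; on this family's statements (very large dependent binder
telescopes through the theta-kernel / dual-pair data) that fold runs for tens of minutes to hours and the build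
lane kills the job (incident G11b-3, run/shared/lean/ops/buildfix/G11b-3-DOSSIER.md). `isDeniedPremise` skips
`[implicit_reducible]` constants before any fold, and a reducibility status on a *theorem* is inert (Meta never
unfolds `thmInfo`; the kernel ignores the attribute), so the public theorems of this file are tagged
`[implicit_reducible]` purely to keep them out of that index. Only other effect: they are not offered by
`+suggestions` premise selectors. No statement or proof is changed; superseded if the operator lands a
deny-list form (`HarnessLib.PremiseIndex`). -/
set_option allowUnsafeReducibility true in
attribute [implicit_reducible]
  _root_.Literature.NumberTheory.GelbartRogawski1991.AdaptedBlocks.blkC_mul_eq_of_isUnit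
  matA_symm_apply blkC_matA_inv_eq_zero deltaTwoGram_skew exists_skew_isUnit_det
  det_sub_smul_eq_eval skew_add_smul_sub exists_skew_forall_isUnit_det isLeftGeneric_bigCell

end Literature.NumberTheory.GelbartRogawski1991.UnitaryDualPair.LocalSplitting

end
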